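import Summits.MatrixMultiplication.OmegaCensus.DominoZpZpScaled
import Summits.MatrixMultiplication.OmegaCensus.DominoZ5LineTable7A
import HarnessLib

/-!
# Kernel covers on `ZMod 5 × ZMod 5`: part `7` (single file) (scaling-canonical table)

ω-census `pub-omega`, family (b3), seat pub-omega-group gen 22 (kit and generators of gen 20).  Framing: lottery ticket; floor =
certified bounds/negative ranges.  VALUE: the finite kernel computation behind the `ℤ_5 × ℤ_5` domino cell theorem with a
part `7` (`DominoZ5Z5Part7.lean`); NOT progress on ω.  Instances of the generic margin-pruned enumeration
`DominoZpZpEnum.lean` with the SCALED table soundness of `DominoZpZpScaled.lean` (table tree `BTree.build`, membership ⇒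
insertion).  Normal form (i): 35 400 leaves / 53 217 nodes in 3 chunks (key `polyBE 2 R % 3`, ≤ 18 744 nodes each);
one file;
the assembly `exists_table_entry_5_7` lives in `DominoZ5Z5Part7.lean`.  Exact Python twin:
`pub-omega-group-g20/code/emulate2.py 5 7 m K`.
-/

namespace Summit.MatrixMultiplication.OmegaCensus

namespace ZpZpDomino

/-- The canonical certified table for part `7` at `p = 5` (= `tableZ5d7ca`, 85 entries). [folklore] -/
noncomputable def tableZ5d7c : List (List ℕ × List (ℕ × List ℕ)) := tableZ5d7ca

/-- Search tree of the codes `polyBE 8 c` of the 48 UNcertified multisets `c` of size 7 on `ZMod 5`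
(330 multisets in all; a scaling-closed set), sorted; untrusted, see `passTreeZ5d7_sound`. [folklore] -/
def passTreeZ5d7 : BTree := BTree.build 64 48 [
  35, 91, 154, 196, 707, 1155, 1232, 1554, 1561, 1736, 1792, 2072, 4179, 4186, 4242, 4690, 4739, 4746, 4802, 5138,
  5145, 5201, 5250, 5257, 5264, 5320, 5649, 5768, 8204, 8211, 8330, 8386, 8449, 8722, 8736, 8778, 8785, 8841, 9240,
  9289, 9296, 9345, 9856, 10304, 12369, 12866, 12936, 13321]

/-- The search tree of the table codes (balanced `BTree.build`; hoisted so that the kernel evaluates it once). [folklore] -/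
noncomputable def tabTreeZ5d7 : BTree := tabTree 8 85 tableZ5d7c

set_option maxHeartbeats 4000000 in
/-- The ONLY fact used about `passTreeZ5d7`: every composition of `7` it does not flag has the code of its canonical scaling
among the keys of `tableZ5d7c` (kernel check `soundChkS` over all 330 compositions). [folklore] -/
theorem passTreeZ5d7_sound : soundChkS 5 7 passTreeZ5d7 tabTreeZ5d7 tableZ5d7c = true := by decide +kernel

set_option maxHeartbeats 4000000 in
/-- Kernel cover computation, `p = 5`, `d = 7`, normal form (i), chunk `0` of `3` (key `polyBE 2 R % 3`). [folklore] -/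
theorem cover_5_7_nf1_0 : coverNF1 5 7 passTreeZ5d7 2 3 0 = true := by decide +kernel

set_option maxHeartbeats 4000000 in
/-- Kernel cover computation, `p = 5`, `d = 7`, normal form (i), chunk `1` of `3` (key `polyBE 2 R % 3`). [folklore] -/
theorem cover_5_7_nf1_1 : coverNF1 5 7 passTreeZ5d7 2 3 1 = true := by decide +kernel

set_option maxHeartbeats 4000000 in
/-- Kernel cover computation, `p = 5`, `d = 7`, normal form (i), chunk `2` of `3` (key `polyBE 2 R % 3`). [folklore] -/
theorem cover_5_7_nf1_2 : coverNF1 5 7 passTreeZ5d7 2 3 2 = true := by decide +kernel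

set_option maxHeartbeats 4000000 in
/-- Kernel cover computation, `p = 5`, `d = 7`, normal form (ii). [folklore] -/
theorem cover_5_7_nf2 : coverNF2 5 7 passTreeZ5d7 = true := by decide +kernel

/-- Kernel cover computation, `p = 5`, `d = 7`, normal form (iii). [folklore] -/
theorem cover_5_7_nf3 : coverNF3 5 7 passTreeZ5d7 = true := by decide +kernel

end ZpZpDomino

end Summit.MatrixMultiplication.OmegaCensus
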